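import Literature.AnabelianGeometry.AbsoluteAnabelian.AbsTopI.RelativeGCInputs
import Literature.AnabelianGeometry.AbsoluteAnabelian.SubpadicExamples
import Literature.AnabelianGeometry.AbsoluteAnabelian.SubpadicIsGeneralizedSubpadic
import HarnessLib

/-!
# [AbsTopI] Example 4.8 (i)/(ii): K4 re-close of cone nodes `AbsTopI:Ex4.8(i)` / `AbsTopI:Ex4.8(ii)` at a
# SPLIT, TAUTOLOGICAL construction-data class (non-degenerate `Δ`, every binder a theorem)

S. Mochizuki, *Topics in Absolute Anabelian Geometry I: Generalities* [AbsTopI] (bib key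
`MochizukiAbsTopI2012`, kurims manuscript pagination), Definition 4.6 (i)(ii) p. 55–56 ("chain-full", "the
rel-isom-DGC / rel-hom-DGC holds") and Example 4.8 (i)/(ii) p. 58 ("the rel-isom-DGC follows from [Mzk5],
Theorem 4.12"; "the rel-hom-DGC follows from [Mzk3], Theorem A" — print's sigla: [Mzk5] = [Tpcs] *Topics Surrounding
the Anabelian Geometry of Hyperbolic Curves*, [Mzk3] = [pGC] *The Local Pro-p Anabelian Geometry of Curves*, [AbsTopI]
references p. 81–82); [Tpcs] Thm 4.12 p. 44; [pGC] Thm A p. 3.  (Doc-only v2: sigla inside the two quotations restored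
to print, finding L18-n2 of abc-iut-ref-l; declarations byte-identical to p511736.)

PROOF-ONLY file (cell abc-iut, seat abc-iut-f-095 gen 12, row «K4B6», director-abc KEY 2026-08-27T07:16:54Z;
NO `def`, NO instance, NO new named fact; the class is built inside the proofs, as in abc-iut-L4-t13's
`RelativeGCHomSchemaWitnesses.lean`).  CONTEXT (abc-iut-c312-2 `CONE-K4-RECLOSE.tsv` v4, class BLOCKED):
the closers of the two nodes — `ConstructionDataClass.ex_4_8_i_of` / `relIsomGC_curves_of_thm_4_12` and
`ex_4_8_ii_of` / `relHomGC_curves_of_thmA` (`AbsTopI/RelativeGC.lean`) — bind the named facts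
`𝒟.RelIsomDGC` (F-0197), `∀ b, Tpcs.Thm_4_12 p (𝒟.fld b) (𝒟.datum b)` (F-0261), `𝒟.RelHomDGC` (F-0196),
`∀ b, pGC.ThmA (𝒟.fld b) (𝒟.datum b)` (F-1794), whose universal closures are REFUTED (junk data) and which
have NO closed producer; the only inhabitants recorded so far are DEGENERATE (the one-field point class over
`ℚ`, `Δ = 1`: abc-iut-w5-d058 `exists_point_rat`, abc-iut-L4-t13 `pGC.exists_datum_thmA_and_thmA_isom`).
The INTENDED instance (étale `π₁` of hyperbolic curves over (generalized) sub-`p`-adic fields) is not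
constructible in the tree (FOUNDATIONS row 12): there the four binders ARE [Tpcs] Thm 4.12 / [pGC] Thm A —
the FACT boundary of the cell.

THIS FILE records the next-best kernel evidence: for EVERY prime `p`, EVERY field `K` sub-`p`-adic for `p`
(e.g. `ℚ_p`, `IsSubpadicFor.padic`) and EVERY profinite group `F`, the SPLIT TAUTOLOGICAL class
`𝒟(K, F)` — one base field `K`; one object over it with `Π := Γ_K × F ↠ Γ_K` (so `Δ ≅ F`, e.g. `F = F̂₂`:
genuine fibre, genuine base, TRIVIAL outer action); scheme morphisms := the OPEN outer homomorphisms
`Π → Π` over `Γ_K` themselves, `f ↦ [π₁(f)]` := the identity, isomorphisms := the bijective classes;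
`Σ := Primes`; no `X̃/X`-chain terms — satisfies `IsEx48ClassGen p` AND `IsEx48ClassSub p`, is chain-full,
and ALL FOUR binders hold at it BY CONSTRUCTION (`exists_splitTautological_binders`); feeding them to the
nodes' closers gives `Ex_4_8_i p` / `Ex_4_8_ii p` and the GC clauses on members with ZERO remaining
hypotheses (`exists_splitTautological_ex_4_8_reclosed`) — the field-side clauses ("`p` serves as `l`",
slimness of `G_K`) being the cell's theorems `cyclotomic_of_isEx48ClassGen`, `Tpcs.lem_4_14_slim_holds`,
`pGC.lem_15_8_slim_holds` (abc-iut-L4-t13 / L4-d1 / L4-d2).  The one lemma with content: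
an outer ISOmorphism over `Γ_K` is open (`isOpen_of_isIso`), so "bijection onto `Isom`" and "bijection
onto `Hom^{open}`" are simultaneously satisfiable by one morphism type.

HONEST LABEL: TAUTOLOGICAL MODEL — the relative GC holds because the morphisms are DEFINED to be the
group-theoretic ones; it shows that OUR typed hypotheses of Def 4.6 (ii) / Thm 4.12 / Thm A are jointly
satisfiable at non-degenerate group data (`Δ ≅ F` arbitrary) together with the Example 4.8 side
conditions, nothing about curves; re-closed-at-a-model ≠ discharged at the intended carrier; no side taken
on [IUTchIII] Cor 3.12; nothing here says abc is proved or refuted.  Axioms standard.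
-/

noncomputable section

namespace Literature.AnabelianGeometry.AbsoluteAnabelian.AbsTopI

open AugmentedProfiniteGrp AbsTopIII
open Literature.AlgebraicGeometry.Frobenioids (IsSlimGroup)

universe u

namespace ConstructionDataClass

/-- An outer ISOmorphism over `G` is an OPEN outer homomorphism (a bijection has full, hence open,
image). [cite: MochizukiLocAn1999, Thm A p.3] -/
theorem _root_.Literature.AnabelianGeometry.AbsoluteAnabelian.AugmentedProfiniteGrp.OuterHom.isOpen_of_isIso
    {G : ProfiniteGrp.{u}} {A B : AugmentedProfiniteGrp G} {c : A.OuterHom B} (hc : c.IsIso) :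
    c.IsOpen := by
  obtain ⟨φ, rfl⟩ := OuterHom.mk_surjective c
  rw [OuterHom.isIso_mk] at hc
  rw [OuterHom.isOpen_mk, HomOver.IsOpenHom, Set.range_eq_univ.mpr hc.2]
  exact isOpen_univ

/-- **The split tautological class and its binders.**  For every prime `p`, every field `K` that is
sub-`p`-adic for `p` and every profinite group `F` there is a construction-data class `𝒟` with: every
construction-data field equal to `K`; every member's extension `Π ↠ Γ_K` split with `Δ ≅ F`
(non-degenerate for `F ≠ 1`); `𝒟` is of the shape of Example 4.8 (i) AND (ii) (`IsEx48ClassGen p`,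
`IsEx48ClassSub p`), chain-full (no chain terms), everything a member and a hyperbolic curve of its datum; and the
FOUR named-fact binders of the nodes' closers HOLD: `RelIsomDGC` (F-0197), `RelHomDGC` (F-0196),
`Tpcs.Thm_4_12 p` field by field (F-0261), `pGC.ThmA` field by field (F-1794) — tautologically, the scheme
morphisms being the open outer homomorphisms over `Γ_K`. [cite: MochizukiAbsTopI2012, Def 4.6 (ii) p.56] -/
theorem exists_splitTautological_binders (p : ℕ) [Fact p.Prime] (K : Type u) [Field K] [CharZero K]
    (hK : IsSubpadicFor K p) (F : ProfiniteGrp.{u}) :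
    ∃ 𝒟 : ConstructionDataClass.{u},
      (∀ b, 𝒟.fld b = K) ∧ (∀ b X, Nonempty (((𝒟.datum b).grp X).geom ≃* F)) ∧
      𝒟.IsEx48ClassGen p ∧ 𝒟.IsEx48ClassSub p ∧ 𝒟.IsChainFull ∧ (∀ b X, 𝒟.Mem b X) ∧
      (∀ b X, 𝒟.Mem b X → (𝒟.datum b).IsHyperbolicCurve X) ∧
      𝒟.RelIsomDGC ∧ 𝒟.RelHomDGC ∧
      (∀ b, Tpcs.Thm_4_12 p (𝒟.fld b) (𝒟.datum b)) ∧ (∀ b, pGC.ThmA (𝒟.fld b) (𝒟.datum b)) := by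
  classical
  let G : ProfiniteGrp.{u} := absoluteGaloisGrp K
  -- the split extension `Γ_K × F ↠ Γ_K`
  let A : AugmentedProfiniteGrp G :=
    { arith := ProfiniteGrp.of (G × F), aug := ContinuousMonoidHom.fst G F,
      aug_surjective := fun g => ⟨(g, 1), rfl⟩ }
  have hgeom : ∀ x : A.arith, x ∈ A.geom ↔ x.1 = 1 := fun x => Iff.rfl
  let e : A.geom ≃* F :=
    { toFun := fun x => x.1.2
      invFun := fun f => ⟨(1, f), (hgeom _).mpr rfl⟩
      left_inv := fun x => by
        ext
        · exact ((hgeom x.1).mp x.2).symm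
        · rfl
      right_inv := fun f => rfl
      map_mul' := fun x y => rfl }
  -- the tautological datum: one object, morphisms := open outer homomorphisms over `Γ_K`
  let D : RelativeAnabelianDatum G :=
    { Obj := PUnit.{u + 1}, Hom := fun _ _ => {c : A.OuterHom A // c.IsOpen},
      IsIso := fun f => f.1.IsIso, IsHyperbolicCurve := fun _ => True, primes := Set.univ,
      grp := fun _ => A, outerHom := fun f => f.1 }
  have hHom : D.RelHomGC := by
    intro X Y _
    refine ⟨fun f _ => f.2, Subtype.val_injective.injOn, fun c hc => ⟨⟨c, hc⟩, Set.mem_univ _, rfl⟩⟩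
  have hIsom : D.RelIsomGC := by
    intro X₁ X₂ _ _
    refine ⟨fun f hf => hf, Subtype.val_injective.injOn, fun c hc => ?_⟩
    exact ⟨⟨c, OuterHom.isOpen_of_isIso hc⟩, hc, rfl⟩
  -- the class: one base field `K`, members := everything, no chain terms
  let 𝒟 : ConstructionDataClass.{u} :=
    { Base := PUnit.{u + 1}, fld := fun _ => K, instField := fun _ => inferInstance,
      instCharZero := fun _ => inferInstance, datum := fun _ => D, Mem := fun _ _ => True,
      IsHyperbolicOrbicurve := fun _ _ => True,
      isHyperbolicOrbicurve_of_isHyperbolicCurve := fun _ _ _ => trivial, chainTerms := fun _ _ => ∅ }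
  refine ⟨𝒟, fun _ => rfl, fun _ _ => ⟨e⟩, ⟨fun _ => hK.isGeneralizedSubpadicFor, fun _ => Set.mem_univ _,
    fun _ _ => Iff.rfl⟩, ⟨fun _ => hK, fun _ => rfl, fun _ _ => Iff.rfl⟩, ?_, fun _ _ => trivial,
    fun _ _ _ => trivial,
    fun _ X₁ X₂ _ _ => hIsom X₁ X₂ trivial trivial, fun _ X₁ X₂ _ _ => hHom X₁ X₂ trivial,
    fun _ _ _ => hIsom, fun _ _ _ => hHom⟩
  intro b X _ t ht
  exact ht.elim

/-- **K4 re-close of `AbsTopI:Ex4.8(i)` and `AbsTopI:Ex4.8(ii)` at the split tautological class.**  For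
every prime `p`, every field `K` sub-`p`-adic for `p` and every profinite group `F`, at a class `𝒟` as in
`exists_splitTautological_binders` (fields `= K`, `Δ ≅ F`) the nodes' CLOSERS apply with EVERY binder a
theorem: `ex_4_8_i_of` (binders `hfull`, `hGC` = F-0197, `hslim` := abc-iut-L4-d1's
`Tpcs.lem_4_14_slim_holds`, `hcyc` := abc-iut-L4-t13's `cyclotomic_of_isEx48ClassGen`) gives the named fact
`Ex_4_8_i p`; `ex_4_8_ii_of_relHomDGC` (binders `hfull`, `hGC` = F-0196) gives `Ex_4_8_ii p`;
`relIsomGC_curves_of_thm_4_12` (binder F-0261) and `relHomGC_curves_of_thmA` (binder F-1794) give the GC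
clauses on members.  ZERO remaining hypotheses.  TAUTOLOGICAL MODEL (GC by construction; non-degenerate
`Δ`); re-closed-at-a-model ≠ discharged at curves. [cite: MochizukiAbsTopI2012, Ex 4.8 (i) p.58] -/
theorem exists_splitTautological_ex_4_8_reclosed (p : ℕ) [Fact p.Prime] (K : Type u) [Field K]
    [CharZero K] (hK : IsSubpadicFor K p) (F : ProfiniteGrp.{u}) :
    ∃ 𝒟 : ConstructionDataClass.{u},
      (∀ b, 𝒟.fld b = K) ∧ (∀ b X, Nonempty (((𝒟.datum b).grp X).geom ≃* F)) ∧
      𝒟.IsEx48ClassGen p ∧ 𝒟.IsEx48ClassSub p ∧ 𝒟.Ex_4_8_i p ∧ 𝒟.Ex_4_8_ii p ∧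
      (∀ (b : 𝒟.Base) (X₁ X₂ : (𝒟.datum b).Obj),
        Set.BijOn ((𝒟.datum b).outerHom (X := X₁) (Y := X₂)) {f | (𝒟.datum b).IsIso f} {c | c.IsIso} ∧
        Set.BijOn ((𝒟.datum b).outerHom (X := X₁) (Y := X₂)) Set.univ {c | c.IsOpen}) ∧
      (∀ b, IsOpen (Set.range (AbsTopIII.cyclotomicChar (𝒟.fld b) p))) ∧
      ∀ b, IsSlimGroup (Field.absoluteGaloisGroup (𝒟.fld b)) := by
  obtain ⟨𝒟, hfld, hΔ, hGen, hSub, hfull, hmem, hcurve, hIsom, hHom, h412, hA⟩ :=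
    exists_splitTautological_binders p K hK F
  refine ⟨𝒟, hfld, hΔ, hGen, hSub,
    ex_4_8_i_of hfull hIsom Tpcs.lem_4_14_slim_holds (cyclotomic_of_isEx48ClassGen hGen),
    ex_4_8_ii_of_relHomDGC hfull hHom, fun b X₁ X₂ => ⟨?_, ?_⟩, cyclotomic_of_isEx48ClassGen hGen,
    slim_of_isEx48ClassGen hGen⟩
  · exact relIsomGC_curves_of_thm_4_12 hGen h412 b X₁ X₂ (hcurve b X₁ (hmem b X₁)) (hcurve b X₂ (hmem b X₂))
  · exact relHomGC_curves_of_thmA hSub hA b X₁ X₂ (hcurve b X₂ (hmem b X₂))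

/-- The same over `ℚ_p` with fibre any profinite group `F` (e.g. `F = F̂₂`, the geometric fundamental group
of a once-punctured elliptic curve over `ℚ̄_p`, as a SPLIT extension — trivial outer Galois action):
`Ex_4_8_i p` and `Ex_4_8_ii p` hold at the split tautological class over `ℚ_p`, zero hypotheses.
TAUTOLOGICAL MODEL. [cite: MochizukiAbsTopI2012, Ex 4.8 (ii) p.58] -/
theorem exists_splitTautological_ex_4_8_reclosed_padic (p : ℕ) [Fact p.Prime] (F : ProfiniteGrp.{0}) :
    ∃ 𝒟 : ConstructionDataClass.{0},
      (∀ b, 𝒟.fld b = ℚ_[p]) ∧ (∀ b X, Nonempty (((𝒟.datum b).grp X).geom ≃* F)) ∧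
      𝒟.IsEx48ClassGen p ∧ 𝒟.IsEx48ClassSub p ∧ 𝒟.Ex_4_8_i p ∧ 𝒟.Ex_4_8_ii p := by
  obtain ⟨𝒟, hfld, hΔ, hGen, hSub, hi, hii, -⟩ :=
    exists_splitTautological_ex_4_8_reclosed p ℚ_[p] (IsSubpadicFor.padic p) F
  exact ⟨𝒟, hfld, hΔ, hGen, hSub, hi, hii⟩

end ConstructionDataClass

end Literature.AnabelianGeometry.AbsoluteAnabelian.AbsTopI
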